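import Literature.NumberTheory.QuadraticFields.JacobiCharacter
import HarnessLib

/-!
# The Jacobi symbol `a ↦ (a / q)` as an `ℤ`-VALUED Dirichlet character modulo `q`

Topic `NumberTheory/QuadraticFields`; namespace `Literature.NumberTheory.QuadraticFields`.  Companion of
`JacobiCharacter.lean`, whose `jacobiChar q : DirichletCharacter ℂ q` is the same character with values in `ℂ`.
Consumers that state laws over `DirichletCharacter ℤ N` (quadratic characters as `MulChar (ZMod N) ℤ`, the type of
Mathlib's `ZMod.χ₄`, `ZMod.χ₈`) need the `ℤ`-valued term: e.g. the cell `bsd-f2-manin` node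
`SigmaEta.KroneckerShimuraCharAtFour` (the Jacobi part of Newman's `η`-quotient multiplier as an even quadratic character
mod `N`), whose proof builds the character as a product of `ZMod.χ₈`, `ZMod.χ₄` and the characters `(· / u)`, `u ∣ N` odd,
lifted to level `N` by `DirichletCharacter.changeLevel`.

## What is here

* `jacobiCharInt q : DirichletCharacter ℤ q` (`q ≠ 0`) — `a ↦ J(a.val | q)` (Mathlib's `jacobiSym`), a multiplicative
  character of `ZMod q` by `jacobiSym.mod_left` / `jacobiSym.mul_left` / `jacobiSym.eq_zero_iff_not_coprime` — VERBATIM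
  the construction of `jacobiChar` with the cast to `ℂ` removed;
* the evaluation lemmas `jacobiCharInt_apply`, `jacobiCharInt_natCast`, `jacobiCharInt_intCast`;
* `jacobiCharInt_ringHomComp : (jacobiCharInt q).ringHomComp (Int.castRingHom ℂ) = jacobiChar q` (the two terms agree);
* values: `jacobiCharInt_trichotomy` (`∈ {0, 1, −1}`), `jacobiCharInt_sq_eq_one` at arguments coprime to `q`,
  `jacobiCharInt_neg_one` (`(−1 / q) = χ₄ q` for odd `q`, Mathlib `jacobiSym.at_neg_one`),
  `jacobiCharInt_eq_one_of_modEq_one` (`(a / q) = 1` when `a ≡ 1` modulo every prime factor of `q`).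

No `instance`, no notation, no named fact; nothing here is specific to any summit.

## References

* [Cox2013] D. A. Cox, *Primes of the form x² + ny²*, 2nd ed. (2013), §1.C Lemma 1.14 and (1.15)–(1.18): the Jacobi
  symbol is multiplicative and periodic in the top argument, hence a character modulo the bottom argument.
* [MontgomeryVaughan2007] H. L. Montgomery, R. C. Vaughan, *Multiplicative Number Theory I*, §9.3 (quadratic characters).
-/

noncomputable section

open scoped NumberTheorySymbols

namespace Literature.NumberTheory.QuadraticFields

/-- **The Jacobi symbol `a ↦ (a / q)` as an `ℤ`-valued Dirichlet character modulo `q`** (`q ≠ 0`): on a residue class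
`a mod q` its value is `J(a.val | q)`; multiplicative by `jacobiSym.mul_left`, well defined by `jacobiSym.mod_left`, zero
exactly on the non-units by `jacobiSym.eq_zero_iff_not_coprime`.  The `ℂ`-valued `jacobiChar q` is its image under
`Int.castRingHom ℂ` (`jacobiCharInt_ringHomComp`). [cite: Cox2013, §1.C Lemma 1.14 (proof, (1.15)–(1.16))] -/
def jacobiCharInt (q : ℕ) [NeZero q] : DirichletCharacter ℤ q where
  toFun a := J((a.val : ℤ) | q)
  map_one' := by
    rw [ZMod.val_one_eq_one_mod, jacobiSym_natCast_mod, Nat.cast_one, jacobiSym.one_left]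
  map_mul' a b := by
    rw [ZMod.val_mul, jacobiSym_natCast_mod, Nat.cast_mul, jacobiSym.mul_left]
  map_nonunit' a ha := by
    have hval : ¬ a.val.Coprime q := fun h => ha (by
      rw [← ZMod.natCast_zmod_val a]
      exact (ZMod.isUnit_iff_coprime a.val q).mpr h)
    rw [jacobiSym.eq_zero_iff_not_coprime, Int.gcd_natCast_natCast]
    exact hval

variable {q : ℕ} [NeZero q]

/-- Unfolding on `ZMod q`: `jacobiCharInt q a = J(a.val | q)`. [cite: Cox2013, §1.C Lemma 1.14 (proof, (1.15)–(1.16))] -/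
theorem jacobiCharInt_apply (a : ZMod q) : jacobiCharInt q a = J((a.val : ℤ) | q) := rfl

/-- `jacobiCharInt q n = J(n | q)` for `n : ℕ` (periodicity of the Jacobi symbol in the top argument, Cox (1.16)).
[cite: Cox2013, §1.C Lemma 1.14 (proof, (1.15)–(1.16))] -/
theorem jacobiCharInt_natCast (n : ℕ) : jacobiCharInt q n = J((n : ℤ) | q) := by
  rw [jacobiCharInt_apply, ZMod.val_natCast, jacobiSym_natCast_mod]

/-- `jacobiCharInt q n = J(n | q)` for `n : ℤ` (periodicity in the top argument, Cox (1.16)).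
[cite: Cox2013, §1.C Lemma 1.14 (proof, (1.15)–(1.16))] -/
theorem jacobiCharInt_intCast (n : ℤ) : jacobiCharInt q n = J(n | q) := by
  have h0 : 0 ≤ n % (q : ℤ) := Int.emod_nonneg _ (by exact_mod_cast NeZero.ne q)
  have h1 : ((n % (q : ℤ)).toNat : ℤ) = n % (q : ℤ) := Int.toNat_of_nonneg h0
  rw [← ZMod.intCast_mod n q, ← h1, Int.cast_natCast, jacobiCharInt_natCast, h1, ← jacobiSym.mod_left]

/-- The `ℂ`-valued Jacobi character of `JacobiCharacter.lean` is the image of the `ℤ`-valued one under `ℤ → ℂ` (the same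
object, Cox's `(·/m)`). [cite: Cox2013, §1.C Lemma 1.14 (proof, (1.15)–(1.16))] -/
theorem jacobiCharInt_ringHomComp : (jacobiCharInt q).ringHomComp (Int.castRingHom ℂ) = jacobiChar q := by
  ext a
  rw [MulChar.ringHomComp_apply, jacobiCharInt_apply, jacobiChar_apply, eq_intCast]

/-- The values of `jacobiCharInt` are `0`, `1` or `−1` (a real = quadratic character). [cite: MontgomeryVaughan2007, §9.3 (quadratic characters)] -/
theorem jacobiCharInt_trichotomy (a : ZMod q) :
    jacobiCharInt q a = 0 ∨ jacobiCharInt q a = 1 ∨ jacobiCharInt q a = -1 := by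
  rw [jacobiCharInt_apply]
  exact jacobiSym.trichotomy _ _

/-- `jacobiCharInt q` is a quadratic character. [cite: MontgomeryVaughan2007, §9.3 (quadratic characters)] -/
theorem isQuadratic_jacobiCharInt : (jacobiCharInt q).IsQuadratic := fun a => jacobiCharInt_trichotomy a

/-- At an integer coprime to `q` the value squares to `1` (it is `±1`). [cite: MontgomeryVaughan2007, §9.3 (quadratic characters)] -/
theorem jacobiCharInt_sq_eq_one {n : ℤ} (h : n.gcd q = 1) : (jacobiCharInt q n) ^ 2 = 1 := by
  rw [jacobiCharInt_intCast]
  exact jacobiSym.sq_one h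

/-- **`(−1 / q) = χ₄(q)` for odd `q`** (first supplement to reciprocity for the Jacobi symbol, Cox (1.17); Mathlib
`jacobiSym.at_neg_one`). [cite: Cox2013, §1.C (1.17)] -/
theorem jacobiCharInt_neg_one (hq : Odd q) : jacobiCharInt q (-1) = ZMod.χ₄ q := by
  rw [show (-1 : ZMod q) = ((-1 : ℤ) : ZMod q) by push_cast; ring, jacobiCharInt_intCast]
  exact jacobiSym.at_neg_one hq

/-- **`(a / q) = 1` when `a ≡ 1` modulo every prime factor of `q`**: the Jacobi symbol is the product of the Legendre
symbols at the prime factors of `q` (with multiplicity), each of which sees only `a mod p = 1` (definition of the Jacobi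
symbol, Cox §1.C before Lemma 1.14, and periodicity of the Legendre symbol).  (Used for `q` odd with
`a = 1 + (multiple of rad q)`, e.g. the lower-right entries of cusp stabilisers of `Γ₀(N)`.) [cite: Cox2013, §1.C (definition of the Jacobi symbol before Lemma 1.14)] -/
theorem jacobiSym_eq_one_of_forall_prime_dvd_sub_one {a : ℤ} {b : ℕ}
    (h : ∀ p : ℕ, p.Prime → p ∣ b → (p : ℤ) ∣ a - 1) : J(a | b) = 1 := by
  induction b using Nat.recOnMul with
  | zero => exact jacobiSym.zero_right a
  | one => exact jacobiSym.one_right a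
  | prime p hp =>
    haveI : Fact p.Prime := ⟨hp⟩
    have h1a : 1 ≡ a [ZMOD (p : ℤ)] := Int.modEq_iff_dvd.mpr (h p hp dvd_rfl)
    rw [← jacobiSym.legendreSym.to_jacobiSym, legendreSym.mod, ← h1a, ← legendreSym.mod, legendreSym.at_one]
  | mul m n hm hn =>
    rcases eq_or_ne m 0 with rfl | hm0
    · rw [zero_mul]; exact jacobiSym.zero_right a
    rcases eq_or_ne n 0 with rfl | hn0
    · rw [mul_zero]; exact jacobiSym.zero_right a
    rw [jacobiSym.mul_right' a hm0 hn0,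
      hm (fun p hp hpm => h p hp (hpm.mul_right n)),
      hn (fun p hp hpn => h p hp (hpn.mul_left m)), one_mul]

/-- **`jacobiCharInt q x = 1` when every prime factor of `q` divides `x − 1`** (e.g. `x = 1 + k·y` with `rad q ∣ y`).
[cite: Cox2013, §1.C (definition of the Jacobi symbol before Lemma 1.14)] -/
theorem jacobiCharInt_natCast_eq_one_of_forall_prime_dvd {x : ℕ}
    (h : ∀ p : ℕ, p.Prime → p ∣ q → (p : ℤ) ∣ (x : ℤ) - 1) : jacobiCharInt q x = 1 := by
  rw [jacobiCharInt_natCast]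
  exact jacobiSym_eq_one_of_forall_prime_dvd_sub_one h

end Literature.NumberTheory.QuadraticFields

end
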